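/-
Copyright (c) 2026 the pub-hodgecm-mathlib formalisation cell (harness21).  Prover seat hodgecm-mathlib-K2E3-p21 (g6), Track B «K2-LIT» ∕ h413
(`stmt-HodgeConjecture-24833`), line `K2_E3_EllipticInputs`, line «SC′-IRR-lev» (lead K2E3-p24 (g2): FILE PLAN v2 2026-09-04T10:20:22Z, HANDS CONFIRMED + SPEC
10:27:03Z), brick BLK; leaf (S-C′-irr) `sig_K2E3GL3TwoBlockInducedIrreducible`.  2026-09-04.
-/
import Summits.HodgeConjecture.HodgeConjecture.Theorems.K2E3GL3MaximalParabolicRelabel            -- ★ K0 (K2E3-p24 g2): `transvectionUnit_{one_zero,zero_one}_mem_standardParabolicGL`, `permGL`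
import Summits.HodgeConjecture.HodgeConjecture.Theorems.K2E3GL3LeviHaarCoordinates              -- ★ (K2E3-p03): `exists_continuousMulEquiv_prod_levi` (`GL₂ × GL₁ ≃ₜ* M`, explicit matrix)
import Summits.HodgeConjecture.HodgeConjecture.Theorems.K2E3GL3KMUAbsContTransport               -- ★ (K2E3-p11): `mem_standardLeviGL_fin2_iff_bool`
import Summits.HodgeConjecture.HodgeConjecture.Theorems.K2E3ParabolicCharacterLeviUnipotentGL   -- ★ (K2E3-p24 g0): `exists_homeomorph_leviProjection_inclusion`
import Summits.HodgeConjecture.HodgeConjecture.Theorems.K2E3CharLocIntNearCentralFactor          -- ★ (K2E3-p11): `exists_character_of_central_factor`, `isSupercuspidal_comp_inl`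
import Summits.HodgeConjecture.HodgeConjecture.Theorems.K2E3GL3OuterAutomorphismInduction       -- ★ (this seat) p859332: `apply_eq_of_mem_unipotentRadicalGL`, `mem_unipotentRadicalP_iff`
import Literature.NumberTheory.Automorphic.ParabolicInductionSupercuspidalProofs                 -- ★ `coinvariantsKer_eq_top_of_isSupercuspidal` (Harish-Chandra's criterion, necessity)
import Literature.NumberTheory.Automorphic.MatrixCoefficientsSupercuspidalAdmissibleProofs       -- ★ `IsSupercuspidal.isAdmissible_of_sigmaCompactSpace`
import Literature.NumberTheory.Automorphic.PAdicRepsJacquetAdmissibilityProofs                   -- ★ `sigmaCompactSpace_levi`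
import Literature.NumberTheory.Automorphic.ParabolicGLReindex                                    -- ★ `IsAdmissible.comp_of_isOpenMap`, `IsSmooth.comp_of_continuous`, `locallyCompactSpace_gl'`
import Literature.NumberTheory.Automorphic.WhittakerTwistedJacquet                               -- ★ `generalLinearGroup_mul_comm_of_le_one`
import Literature.NumberTheory.Automorphic.CongruenceSubgroupExpansionGL                         -- ★ `nonarchimedeanGroup_gl`
import Literature.NumberTheory.Rogawski1990.SupercuspidalNotSphericalCofinite                    -- ★ `IsSupercuspidal.comp_continuousMulEquiv`
import HarnessLib

/-!
# Crux `H413` — K2-LIT E3, line «SC′-IRR-lev», brick BLK: an irreducible supercuspidal `σ` on the Levi `GL₂(F) × GL₁(F)` of `Q = P_{(2,1)} ≤ GL₃(F)` has NO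
# coinvariants under either root group `X₁₀`, `X₀₁` of its `GL₂` block — `W = ⟨σ(x_{ij}(y)) v − v⟩` — and the Levi acts irreducibly through `σ′ = (σ ∘ proj) ⊗ δ^{1∕2}`

Cell `hodgecm-mathlib`, Track B, line `K2_E3_EllipticInputs`; leaf (S-C′-irr) `sig_K2E3GL3TwoBlockInducedIrreducible` (U12 :491).  In the line's currency (lead K2E3-p24
(g2)): `c₀ := ![0,0,1] : Fin 3 → Fin 2`, `P := standardParabolicGL F c₀`, `x_{ij}(y) := transvectionUnit i j _ y`, inducing datum `σ′ := twist (σ.comp (leviProjection F c₀))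
(rootDeltaChar P)` on `↥P` for `σ` irreducible smooth supercuspidal on `Π a, GL {i ∕∕ c₀ i = a} F`.  Bricks JM-A `K2E3GL3CuspidalBlockJacquetSame` ∕ JM-B
`K2E3GL3CuspidalBlockJacquetCross` are hypothesis-first on `hW : ∀ w, w ∈ span ℂ {σ′ ⟨x₁₀ y, _⟩ v − v}` ∕ `hW₀₁ : ∀ w, w ∈ span ℂ {σ′ ⟨x₀₁ a, _⟩ v − v}` and on the
Levi-irreducibility letter `hirr`; this file DISCHARGES all three (SPEC 10:27:03Z).  THEOREMS ONLY; count-neutral helper (`--supports stmt-HodgeConjecture-24833 --as helper`).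

THE ARGUMENT (all inputs ★).  Transport `σ` to `τ := σ ∘ E` on `GL₂(F) × GL₁(F)` along an isomorphism of topological groups `E` with `E (x, b) = proj_{c₀}` of the block
matrix `!![x₀₀,x₀₁,0; x₁₀,x₁₁,0; 0,0,b]` (★ `exists_continuousMulEquiv_prod_levi`, ★ `mem_standardLeviGL_fin2_iff_bool`, ★ `exists_homeomorph_leviProjection_inclusion`); `τ` is
irreducible, smooth, supercuspidal, admissible (★ transports, ★ `isAdmissible_of_sigmaCompactSpace`); the central factor `GL₁` acts by a character (★ `exists_character_of_central_factor`),
so `τ ∘ inl` is smooth SUPERCUSPIDAL on `GL₂(F)` (★ `isSupercuspidal_comp_inl`); Harish-Chandra's criterion (★ `coinvariantsKer_eq_top_of_isSupercuspidal`) at the labellings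
`![1,0]` (radical `X₁₀`) and `![0,1]` (radical `X₀₁`) gives `W = ⟨τ(u,1)v − v : u ∈ X_{ij}⟩`; `u = x_{ij}(u_{ij})` and `E (x_{ij}(y), 1) = proj_{c₀} ⟨x_{ij}(y), K0⟩`.  `δ_P^{1∕2}(x_{ij}(y)) = 1`:
`x_{ij}(y)` lies in the compact subgroup `x_{ij}({z : |z| ≤ |y|})` of `P` (★ `modularCharacter_eq_one_of_mem_isCompact`).

* §1 `eq_transvectionUnit_of_mem_unipotentRadicalGL_{one_zero,zero_one}` (`U_{![1,0]} = X₁₀`, `U_{![0,1]} = X₀₁` in `GL₂`), `exists_continuousMulEquiv_levi_two_one` (the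
  model `E`, with matrix) and `exists_continuousMulEquiv_levi_two_one_transvection` (`E (x_{ij} y, 1) = proj_{c₀} ⟨x_{ij} y, K0⟩`).
* §2 `rootDeltaChar_eq_one_of_transvectionUnit` (any root group inside `P`), **`rootDeltaChar_transvectionUnit_one_zero`**, **`rootDeltaChar_transvectionUnit_zero_one`**.
* §3 engine `mem_span_unipotent_sub` (any proper labelling `c` of `GL₂`); HEADS **`mem_span_transvection_one_zero_sub`**, **`mem_span_transvection_zero_one_sub`** (`σ ∘ proj`
  form) and **`mem_span_twist_transvection_one_zero_sub`**, **`mem_span_twist_transvection_zero_one_sub`** (the `σ′` form = JM-A's `hW`, JM-B's `hW₀₁`).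
* §4 JM-A's **`twist_leviProjection_apply_eq_self_of_mem_unipotentRadicalP`** (`htriv`) and **`forall_submodule_eq_bot_or_top_of_leviStable`** (`hirr`, over `leviEmbeddingP F c₀ m`);
  JM-B's **`forall_submodule_eq_bot_or_top_of_leviStable_rev`** (`hirr` over `σ′ ⟨w₀ · blockDiagonalGL F ![0,1,1] m · w₀⁻¹, _⟩`, `w₀ = permGL Fin.revPerm`).

HONEST LABEL: HC_CM is proved only modulo the 7 printed citations (2 remaining named inputs: hLiu418 = stmt-HodgeConjecture-24832, h413 =
stmt-HodgeConjecture-24833) until rung 0 closes; elementary given ★ Harish-Chandra's criterion; closes no organ by itself.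

## References
* [HarishChandra1970] Harish-Chandra (notes by G. van Dijk), *Harmonic Analysis on Reductive p-adic Groups*, LNM 162 (1970), Part I §3 p. 9 (Jacquet modules of supercuspidals).
* [BernsteinZelevinsky1976] I. N. Bernstein, A. V. Zelevinsky, Russian Math. Surveys 31:3 (1976), Thm. 3.21, §2.10–2.11 (Schur's lemma).
* [BernsteinZelevinsky1977] I. N. Bernstein, A. V. Zelevinsky, Ann. Sci. ÉNS 10 (1977), §1.7, §2.1 (parabolic data `(P, M, U)`, `δ^{1∕2}`).
* [BushnellHenniart2006] C. J. Bushnell, G. Henniart, *The Local Langlands Conjecture for GL(2)* (2006), §2.6 Cor. 1, §10.1–10.2.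
-/

set_option autoImplicit false
-- the mandated namespace repeats `HodgeConjecture.HodgeConjecture`, as in every `Theorems/*.lean` of this sub-problem
set_option linter.dupNamespace false

noncomputable section

open Literature.NumberTheory.Automorphic Representation ValuativeRel
open Summit.HodgeConjecture.HodgeConjecture.Cruxes.H413
open Summit.HodgeConjecture.HodgeConjecture.Cruxes.H413.K2E3GL3MaximalParabolicRelabel

namespace Summit.HodgeConjecture.HodgeConjecture.Cruxes.H413.K2E3GL3CuspidalBlockRestriction

variable (F : Type*) [Field F] [ValuativeRel F] [TopologicalSpace F] [IsNonarchimedeanLocalField F]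

/-! ## §1  The root groups `X₁₀`, `X₀₁` of `GL₂`, and the model `GL₂(F) × GL₁(F)` of the Levi of `P_{(2,1)}` -/

omit [ValuativeRel F] [TopologicalSpace F] [IsNonarchimedeanLocalField F] in
/-- **`U_{![1,0]} = X₁₀`**: an element of the unipotent radical of the LOWER labelling `![1,0]` of `GL₂` is the transvection `x₁₀(u₁₀)`. [cite: BernsteinZelevinsky1977, §2.1] -/
theorem eq_transvectionUnit_of_mem_unipotentRadicalGL_one_zero {u : GL (Fin 2) F} (hu : u ∈ unipotentRadicalGL F (![1, 0] : Fin 2 → Fin 2)) :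
    u = transvectionUnit (n := 2) 1 0 (by decide) ((u : Matrix (Fin 2) (Fin 2) F) 1 0) := by
  have h00 := K2E3GL3OuterAutomorphismInduction.apply_eq_of_mem_unipotentRadicalGL (![1, 0] : Fin 2 → Fin 2) hu 0 0 rfl
  have h11 := K2E3GL3OuterAutomorphismInduction.apply_eq_of_mem_unipotentRadicalGL (![1, 0] : Fin 2 → Fin 2) hu 1 1 rfl
  have h01 : (u : Matrix (Fin 2) (Fin 2) F) 0 1 = 0 := (unipotentRadicalGL_le F _ hu) (show (![1, 0] : Fin 2 → Fin 2) 1 < ![1, 0] 0 by decide)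
  apply Units.ext
  ext i j
  rw [coe_transvectionUnit, Matrix.add_apply, Matrix.one_apply, Matrix.single_apply]
  fin_cases i <;> fin_cases j
  · simpa using h00
  · simpa using h01
  · simp
  · simpa using h11

omit [ValuativeRel F] [TopologicalSpace F] [IsNonarchimedeanLocalField F] in
/-- **`U_{![0,1]} = X₀₁`**: an element of the unipotent radical of the standard labelling `![0,1]` of `GL₂` (upper unitriangular matrices) is the transvection `x₀₁(u₀₁)`.
[cite: BernsteinZelevinsky1977, §2.1] -/
theorem eq_transvectionUnit_of_mem_unipotentRadicalGL_zero_one {u : GL (Fin 2) F} (hu : u ∈ unipotentRadicalGL F (![0, 1] : Fin 2 → Fin 2)) :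
    u = transvectionUnit (n := 2) 0 1 (by decide) ((u : Matrix (Fin 2) (Fin 2) F) 0 1) := by
  have h00 := K2E3GL3OuterAutomorphismInduction.apply_eq_of_mem_unipotentRadicalGL (![0, 1] : Fin 2 → Fin 2) hu 0 0 rfl
  have h11 := K2E3GL3OuterAutomorphismInduction.apply_eq_of_mem_unipotentRadicalGL (![0, 1] : Fin 2 → Fin 2) hu 1 1 rfl
  have h10 : (u : Matrix (Fin 2) (Fin 2) F) 1 0 = 0 := (unipotentRadicalGL_le F _ hu) (show (![0, 1] : Fin 2 → Fin 2) 0 < ![0, 1] 1 by decide)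
  apply Units.ext
  ext i j
  rw [coe_transvectionUnit, Matrix.add_apply, Matrix.one_apply, Matrix.single_apply]
  fin_cases i <;> fin_cases j
  · simpa using h00
  · simp
  · simpa using h10
  · simpa using h11

/-- **THE MODEL `E : GL₂(F) × GL₁(F) ≃ₜ* Π_a GL {i ∕∕ c₀ i = a} F` OF THE LEVI OF `P_{(2,1)}`**, with `E (x, b) = proj_{c₀} m` for an `m ∈ P_{c₀}` whose matrix is the block matrix
`!![x₀₀, x₀₁, 0; x₁₀, x₁₁, 0; 0, 0, b₀₀]` (★ `exists_continuousMulEquiv_prod_levi` ∘ relabelling ★ `mem_standardLeviGL_fin2_iff_bool` ∘ ★ `exists_homeomorph_leviProjection_inclusion`).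
[cite: BernsteinZelevinsky1977, §2.1] -/
theorem exists_continuousMulEquiv_levi_two_one :
    ∃ E : (GL (Fin 2) F × GL (Fin 1) F) ≃ₜ* (Π a, GL {i // (![0, 0, 1] : Fin 3 → Fin 2) i = a} F),
      ∀ x : GL (Fin 2) F × GL (Fin 1) F, ∃ m : ↥(standardParabolicGL F (![0, 0, 1] : Fin 3 → Fin 2)),
        E x = leviProjection F (![0, 0, 1] : Fin 3 → Fin 2) m ∧
        ((m : GL (Fin 3) F) : Matrix (Fin 3) (Fin 3) F) =
          !![(x.1 : Matrix (Fin 2) (Fin 2) F) 0 0, (x.1 : Matrix (Fin 2) (Fin 2) F) 0 1, 0;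
             (x.1 : Matrix (Fin 2) (Fin 2) F) 1 0, (x.1 : Matrix (Fin 2) (Fin 2) F) 1 1, 0;
             0, 0, (x.2 : Matrix (Fin 1) (Fin 1) F) 0 0] := by
  haveI : IsTopologicalRing F := inferInstance
  obtain ⟨e₀, he₀⟩ := K2E3GL3LeviHaarCoordinates.exists_continuousMulEquiv_prod_levi (F := F)
  have hM : standardLeviGL F (![false, false, true] : Fin 3 → Bool) = standardLeviGL F (![0, 0, 1] : Fin 3 → Fin 2) :=
    (Subgroup.ext fun g => (K2E3GL3KMUAbsContTransport.mem_standardLeviGL_fin2_iff_bool (F := F) g).1).symm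
  -- the relabelling, identity on `GL₃(F)`
  let ι : ↥(standardLeviGL F (![false, false, true] : Fin 3 → Bool)) ≃ₜ* ↥(standardLeviGL F (![0, 0, 1] : Fin 3 → Fin 2)) :=
    { MulEquiv.subgroupCongr hM with
      continuous_toFun := Continuous.subtype_mk continuous_subtype_val _
      continuous_invFun := Continuous.subtype_mk continuous_subtype_val _ }
  have hι : ∀ m, ((ι m : ↥(standardLeviGL F (![0, 0, 1] : Fin 3 → Fin 2))) : GL (Fin 3) F) = (m : GL (Fin 3) F) := fun _ => rfl
  -- `proj ∘ incl : M_{c₀} ≃ₜ* Π_a GL`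
  obtain ⟨h, hh⟩ := K2E3ParabolicCharacterLeviUnipotentGL.exists_homeomorph_leviProjection_inclusion F (![0, 0, 1] : Fin 3 → Fin 2)
  let η : ↥(standardLeviGL F (![0, 0, 1] : Fin 3 → Fin 2)) ≃ₜ* (Π a, GL {i // (![0, 0, 1] : Fin 3 → Fin 2) i = a} F) :=
    { toEquiv := h.toEquiv
      map_mul' := fun x y => by
        change h (x * y) = h x * h y
        rw [hh, hh, hh, map_mul, map_mul]
      continuous_toFun := h.continuous
      continuous_invFun := h.symm.continuous }
  have hη : ∀ m, η m = leviProjection F (![0, 0, 1] : Fin 3 → Fin 2) (Subgroup.inclusion (standardLeviGL_le F _) m) := fun m => hh m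
  refine ⟨(e₀.trans ι).trans η, fun x => ⟨Subgroup.inclusion (standardLeviGL_le F _) (ι (e₀ x)), ?_, ?_⟩⟩
  · change η (ι (e₀ x)) = _
    rw [hη]
  · rw [Subgroup.coe_inclusion, hι]
    exact he₀ x

/-- **`E (x₁₀(y), 1) = proj_{c₀} ⟨x₁₀(y), K0⟩` and `E (x₀₁(a), 1) = proj_{c₀} ⟨x₀₁(a), K0⟩`** for a model `E` as in `exists_continuousMulEquiv_levi_two_one` (the block matrix of
`(x_{ij}(y), 1)` IS `x_{ij}(y) ∈ GL₃`). [cite: BernsteinZelevinsky1977, §2.1] -/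
theorem exists_continuousMulEquiv_levi_two_one_transvection :
    ∃ E : (GL (Fin 2) F × GL (Fin 1) F) ≃ₜ* (Π a, GL {i // (![0, 0, 1] : Fin 3 → Fin 2) i = a} F),
      (∀ y : F, E (transvectionUnit (n := 2) 1 0 (by decide) y, 1) =
        leviProjection F (![0, 0, 1] : Fin 3 → Fin 2) ⟨transvectionUnit 1 0 (by decide) y, transvectionUnit_one_zero_mem_standardParabolicGL y⟩) ∧
      (∀ a : F, E (transvectionUnit (n := 2) 0 1 (by decide) a, 1) =
        leviProjection F (![0, 0, 1] : Fin 3 → Fin 2) ⟨transvectionUnit 0 1 (by decide) a, transvectionUnit_zero_one_mem_standardParabolicGL a⟩) := by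
  obtain ⟨E, hE⟩ := exists_continuousMulEquiv_levi_two_one F
  -- an element of `P` with the block matrix of `(x, 1)` computes `E (x, 1)`
  have key : ∀ (x : GL (Fin 2) F) (g : GL (Fin 3) F) (hg : g ∈ standardParabolicGL F (![0, 0, 1] : Fin 3 → Fin 2)),
      (g : Matrix (Fin 3) (Fin 3) F) = !![(x : Matrix (Fin 2) (Fin 2) F) 0 0, (x : Matrix (Fin 2) (Fin 2) F) 0 1, 0;
        (x : Matrix (Fin 2) (Fin 2) F) 1 0, (x : Matrix (Fin 2) (Fin 2) F) 1 1, 0; 0, 0, 1] →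
      E (x, 1) = leviProjection F (![0, 0, 1] : Fin 3 → Fin 2) ⟨g, hg⟩ := by
    intro x g hg h
    obtain ⟨m, hm, hmat⟩ := hE (x, 1)
    rw [hm]
    congr 1
    apply Subtype.ext; apply Units.ext
    rw [hmat, h, Units.val_one, Matrix.one_apply_eq]
  refine ⟨E, fun y => key _ _ _ ?_, fun a => key _ _ _ ?_⟩ <;>
  · ext i j
    fin_cases i <;> fin_cases j <;> simp [coe_transvectionUnit]

/-! ## §2  `δ_P^{1∕2} = 1` on the root groups of the `GL₂` block -/

/-- **`δ_P^{1∕2}(x_{ij}(y)) = 1` for a root group `x_{ij}(F) ≤ P`**: `x_{ij}(y)` lies in the compact subgroup `x_{ij}({z : |z| ≤ |y|})` of `P`, on which the modular character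
is trivial (★ `modularCharacter_eq_one_of_mem_isCompact`). [cite: BernsteinZelevinsky1977, §1.7] -/
theorem rootDeltaChar_eq_one_of_transvectionUnit {P : Subgroup (GL (Fin 3) F)} [LocallyCompactSpace ↥P] {i j : Fin 3} (hij : i ≠ j)
    (hmem : ∀ z : F, transvectionUnit i j hij z ∈ P) (y : F) : rootDeltaChar P ⟨transvectionUnit i j hij y, hmem y⟩ = 1 := by
  haveI : IsTopologicalRing F := inferInstance
  have hmul : ∀ z z' : F, transvectionUnit (n := 3) i j hij z * transvectionUnit (n := 3) i j hij z' = transvectionUnit (n := 3) i j hij (z + z') :=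
    fun z z' => Units.ext (Matrix.transvection_mul_transvection_same i j hij z z')
  -- the compact subgroup `K_y = x_{ij}({z : |z| ≤ |y|})` of `P`
  let K : Subgroup ↥P :=
    { carrier := {p | ∃ z : F, valuation F z ≤ valuation F y ∧ (p : GL (Fin 3) F) = transvectionUnit (n := 3) i j hij z}
      mul_mem' := by
        rintro p q ⟨z, hz, hp⟩ ⟨z', hz', hq⟩
        exact ⟨z + z', (Valuation.map_add _ z z').trans (max_le hz hz'), by rw [Subgroup.coe_mul, hp, hq, hmul]⟩
      one_mem' := ⟨0, by rw [map_zero]; exact zero_le, by rw [Subgroup.coe_one, transvectionUnit_zero]⟩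
      inv_mem' := by
        rintro p ⟨z, hz, hp⟩
        exact ⟨-z, by rwa [Valuation.map_neg], by rw [Subgroup.coe_inv, hp, transvectionUnit_inv]⟩ }
  have hKc : IsCompact (K : Set ↥P) := by
    have hcT : ∀ s : F → F, Continuous s → Continuous fun z : F => Matrix.transvection i j (s z) := fun s hs =>
      continuous_matrix fun a b => by
        simp only [Matrix.transvection, Matrix.add_apply, Matrix.single_apply]
        split_ifs <;> fun_prop
    have hcont : Continuous fun z : F => (⟨transvectionUnit (n := 3) i j hij z, hmem z⟩ : ↥P) :=
      Continuous.subtype_mk (Units.continuous_iff.2 ⟨hcT id continuous_id, hcT Neg.neg continuous_neg⟩) _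
    have himage : (K : Set ↥P) = (fun z : F => (⟨transvectionUnit (n := 3) i j hij z, hmem z⟩ : ↥P)) '' {z : F | valuation F z ≤ valuation F y} := by
      ext p
      constructor
      · rintro ⟨z, hz, hp⟩; exact ⟨z, hz, Subtype.ext hp.symm⟩
      · rintro ⟨z, hz, rfl⟩; exact ⟨z, hz, rfl⟩
    rw [himage]
    exact (IsNonarchimedeanLocalField.isCompact_closedBall F (valuation F y)).image hcont
  have hyK : (⟨transvectionUnit (n := 3) i j hij y, hmem y⟩ : ↥P) ∈ K := ⟨y, le_rfl, rfl⟩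
  borelize ↥P
  have h1 : MeasureTheory.Measure.modularCharacter (⟨transvectionUnit (n := 3) i j hij y, hmem y⟩ : ↥P) = 1 :=
    modularCharacter_eq_one_of_mem_isCompact hKc hyK
  ext
  rw [rootDeltaChar_apply, h1, NNReal.sqrt_one, NNReal.coe_one, Complex.ofReal_one, Units.val_one]

/-- **`δ_P^{1∕2}(x₁₀(y)) = 1`** (`P = P_{c₀}`; so `σ′ ⟨x₁₀ y, _⟩ = σ (proj_{c₀} ⟨x₁₀ y, _⟩)` for `σ′ = twist (σ.comp (leviProjection F c₀)) (rootDeltaChar P)`).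
[cite: BernsteinZelevinsky1977, §1.7] -/
theorem rootDeltaChar_transvectionUnit_one_zero (y : F) :
    rootDeltaChar (standardParabolicGL F (![0, 0, 1] : Fin 3 → Fin 2)) ⟨transvectionUnit 1 0 (by decide) y, transvectionUnit_one_zero_mem_standardParabolicGL y⟩ = 1 :=
  rootDeltaChar_eq_one_of_transvectionUnit F (by decide) transvectionUnit_one_zero_mem_standardParabolicGL y

/-- **`δ_P^{1∕2}(x₀₁(a)) = 1`** (`P = P_{c₀}`). [cite: BernsteinZelevinsky1977, §1.7] -/
theorem rootDeltaChar_transvectionUnit_zero_one (a : F) :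
    rootDeltaChar (standardParabolicGL F (![0, 0, 1] : Fin 3 → Fin 2)) ⟨transvectionUnit 0 1 (by decide) a, transvectionUnit_zero_one_mem_standardParabolicGL a⟩ = 1 :=
  rootDeltaChar_eq_one_of_transvectionUnit F (by decide) transvectionUnit_zero_one_mem_standardParabolicGL a

/-! ## §3  `W = W(X₁₀) = W(X₀₁)` for `σ` irreducible supercuspidal on the Levi -/

/-- **ENGINE (Harish-Chandra's criterion on the `GL₂` block).**  `σ` irreducible smooth supercuspidal on `Π_a GL {i ∕∕ c₀ i = a} F`, `E : GL₂ × GL₁ ≃ₜ* Π_a GL …` any isomorphism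
of topological groups, `c` a proper labelling of `GL₂`: every `w ∈ W` lies in `⟨σ(E(u,1)) v − v : u ∈ U_c, v ∈ W⟩`.  Transport `τ = σ ∘ E`; Schur on the central `GL₁` (★
`exists_character_of_central_factor`); `τ ∘ inl` supercuspidal (★ `isSupercuspidal_comp_inl`); ★ `coinvariantsKer_eq_top_of_isSupercuspidal`.
[cite: HarishChandra1970, Part I §3 p. 9] [cite: BushnellHenniart2006, §10.2] [cite: BernsteinZelevinsky1976, Thm. 3.21] -/
theorem mem_span_unipotent_sub {W : Type*} [AddCommGroup W] [Module ℂ W]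
    (σ : Representation ℂ (Π a, GL {i // (![0, 0, 1] : Fin 3 → Fin 2) i = a} F) W) [σ.IsIrreducible] (hσ : σ.IsSmooth) (hsc : σ.IsSupercuspidal)
    (E : (GL (Fin 2) F × GL (Fin 1) F) ≃ₜ* (Π a, GL {i // (![0, 0, 1] : Fin 3 → Fin 2) i = a} F)) {c : Fin 2 → Fin 2} (hc : IsProperBlocks c) (w : W) :
    w ∈ Submodule.span ℂ {x : W | ∃ (u : GL (Fin 2) F) (v : W), u ∈ unipotentRadicalGL F c ∧ x = σ (E (u, 1)) v - v} := by
  haveI : IsTopologicalRing F := inferInstance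
  haveI : NonarchimedeanGroup (GL (Fin 2) F) := nonarchimedeanGroup_gl F 2
  haveI : NonarchimedeanGroup (GL (Fin 1) F) := nonarchimedeanGroup_gl F 1
  haveI : LocallyCompactSpace (GL (Fin 2) F) := locallyCompactSpace_gl' F (Fin 2)
  haveI : LocallyCompactSpace (GL (Fin 1) F) := locallyCompactSpace_gl' F (Fin 1)
  haveI : SigmaCompactSpace (Π a, GL {i // (![0, 0, 1] : Fin 3 → Fin 2) i = a} F) := sigmaCompactSpace_levi F _
  have hadm : σ.IsAdmissible := IsSupercuspidal.isAdmissible_of_sigmaCompactSpace hσ hsc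
  set τ : Representation ℂ (GL (Fin 2) F × GL (Fin 1) F) W :=
    σ.comp (E : (GL (Fin 2) F × GL (Fin 1) F) →* (Π a, GL {i // (![0, 0, 1] : Fin 3 → Fin 2) i = a} F)) with hτdef
  haveI hτirr : τ.IsIrreducible :=
    isIrreducible_comp_of_surjective σ (E : (GL (Fin 2) F × GL (Fin 1) F) →* (Π a, GL {i // (![0, 0, 1] : Fin 3 → Fin 2) i = a} F)) E.surjective
  have hτsm : τ.IsSmooth := IsSmooth.comp_of_continuous σ _ E.continuous hσ
  have hτadm : τ.IsAdmissible := IsAdmissible.comp_of_isOpenMap σ _ E.continuous E.toHomeomorph.isOpenMap hadm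
  have hτsc : τ.IsSupercuspidal := hsc.comp_continuousMulEquiv E
  -- Schur on the central `GL₁`, and `τ ∘ inl` supercuspidal on `GL₂(F)`
  have hA : ∀ a b : GL (Fin 1) F, a * b = b * a := generalLinearGroup_mul_comm_of_le_one le_rfl
  obtain ⟨χ, hχ, hτχ⟩ := K2E3CharLocIntNearCentralFactor.exists_character_of_central_factor τ hτadm hA
  have hsc₂ : Representation.IsSupercuspidal (τ.comp (MonoidHom.inl (GL (Fin 2) F) (GL (Fin 1) F))) :=
    K2E3CharLocIntNearCentralFactor.isSupercuspidal_comp_inl τ hτsc hχ hτχ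
  have hsm₂ : Representation.IsSmooth (τ.comp (MonoidHom.inl (GL (Fin 2) F) (GL (Fin 1) F))) :=
    IsSmooth.comp_of_continuous τ _ (continuous_id.prodMk continuous_const) hτsm
  -- Harish-Chandra's criterion at the labelling `c`
  have hker := coinvariantsKer_eq_top_of_isSupercuspidal (τ.comp (MonoidHom.inl (GL (Fin 2) F) (GL (Fin 1) F))) hsm₂ hsc₂ hc
  have hw : w ∈ Representation.Coinvariants.ker (restrictUnipotentGL F c (τ.comp (MonoidHom.inl (GL (Fin 2) F) (GL (Fin 1) F)))) := by
    rw [hker]; exact Submodule.mem_top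
  refine Submodule.span_le.2 ?_ hw
  rintro _ ⟨⟨u, v⟩, rfl⟩
  exact Submodule.subset_span ⟨((u : ↥(standardParabolicGL F c)) : GL (Fin 2) F), v,
    (K2E3GL3OuterAutomorphismInduction.mem_unipotentRadicalP_iff F c _).1 u.2, rfl⟩

/-- **BLK HEAD (x₁₀, `σ ∘ proj` form): the LOWER root group `X₁₀` of the `GL₂` block has no coinvariants on an irreducible smooth supercuspidal `σ` of the Levi of `P_{(2,1)}`** —
every `w ∈ W` lies in `⟨σ(proj_{c₀} ⟨x₁₀(y), K0⟩) v − v : y ∈ F, v ∈ W⟩` (engine at the labelling `![1,0]`, `U_{![1,0]} = X₁₀`, `E (x₁₀ y, 1) = proj ⟨x₁₀ y, _⟩`).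
[cite: HarishChandra1970, Part I §3 p. 9] [cite: BushnellHenniart2006, §10.2] -/
theorem mem_span_transvection_one_zero_sub {W : Type*} [AddCommGroup W] [Module ℂ W]
    (σ : Representation ℂ (Π a, GL {i // (![0, 0, 1] : Fin 3 → Fin 2) i = a} F) W) [σ.IsIrreducible] (hσ : σ.IsSmooth) (hsc : σ.IsSupercuspidal) (w : W) :
    w ∈ Submodule.span ℂ {x : W | ∃ (y : F) (v : W), x = σ (leviProjection F (![0, 0, 1] : Fin 3 → Fin 2)
      ⟨transvectionUnit 1 0 (by decide) y, transvectionUnit_one_zero_mem_standardParabolicGL y⟩) v - v} := by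
  obtain ⟨E, hE10, -⟩ := exists_continuousMulEquiv_levi_two_one_transvection F
  have hc : IsProperBlocks (![1, 0] : Fin 2 → Fin 2) := ⟨fun b => by fin_cases b <;> [exact ⟨1, rfl⟩; exact ⟨0, rfl⟩], inferInstance⟩
  refine Submodule.span_mono ?_ (mem_span_unipotent_sub F σ hσ hsc E hc w)
  rintro _ ⟨u, v, hu, rfl⟩
  refine ⟨(u : Matrix (Fin 2) (Fin 2) F) 1 0, v, ?_⟩
  rw [← hE10, ← eq_transvectionUnit_of_mem_unipotentRadicalGL_one_zero F hu]

/-- **BLK HEAD (x₀₁, `σ ∘ proj` form): the UPPER root group `X₀₁` of the `GL₂` block has no coinvariants on an irreducible smooth supercuspidal `σ` of the Levi of `P_{(2,1)}`** —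
every `w ∈ W` lies in `⟨σ(proj_{c₀} ⟨x₀₁(a), K0⟩) v − v : a ∈ F, v ∈ W⟩` (engine at the standard labelling `![0,1]`).
[cite: HarishChandra1970, Part I §3 p. 9] [cite: BushnellHenniart2006, §10.2] -/
theorem mem_span_transvection_zero_one_sub {W : Type*} [AddCommGroup W] [Module ℂ W]
    (σ : Representation ℂ (Π a, GL {i // (![0, 0, 1] : Fin 3 → Fin 2) i = a} F) W) [σ.IsIrreducible] (hσ : σ.IsSmooth) (hsc : σ.IsSupercuspidal) (w : W) :
    w ∈ Submodule.span ℂ {x : W | ∃ (a : F) (v : W), x = σ (leviProjection F (![0, 0, 1] : Fin 3 → Fin 2)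
      ⟨transvectionUnit 0 1 (by decide) a, transvectionUnit_zero_one_mem_standardParabolicGL a⟩) v - v} := by
  obtain ⟨E, -, hE01⟩ := exists_continuousMulEquiv_levi_two_one_transvection F
  have hc : IsProperBlocks (![0, 1] : Fin 2 → Fin 2) := ⟨fun b => by fin_cases b <;> [exact ⟨0, rfl⟩; exact ⟨1, rfl⟩], inferInstance⟩
  refine Submodule.span_mono ?_ (mem_span_unipotent_sub F σ hσ hsc E hc w)
  rintro _ ⟨u, v, hu, rfl⟩
  refine ⟨(u : Matrix (Fin 2) (Fin 2) F) 0 1, v, ?_⟩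
  rw [← hE01, ← eq_transvectionUnit_of_mem_unipotentRadicalGL_zero_one F hu]

/-- **BLK HEAD (x₁₀, inducing-datum form) = JM-A's binder `hW`**: for `σ′ = twist (σ.comp (leviProjection F c₀)) (rootDeltaChar P)`, every `w ∈ W` lies in
`⟨σ′ ⟨x₁₀ y, K0⟩ v − v⟩` (x₁₀ head + `δ^{1∕2}(x₁₀ y) = 1`). [cite: HarishChandra1970, Part I §3 p. 9] [cite: BernsteinZelevinsky1977, §1.7] -/
theorem mem_span_twist_transvection_one_zero_sub {W : Type*} [AddCommGroup W] [Module ℂ W]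
    (σ : Representation ℂ (Π a, GL {i // (![0, 0, 1] : Fin 3 → Fin 2) i = a} F) W) [σ.IsIrreducible] (hσ : σ.IsSmooth) (hsc : σ.IsSupercuspidal) (w : W) :
    w ∈ Submodule.span ℂ {x : W | ∃ (y : F) (v : W),
      x = Representation.twist (σ.comp (leviProjection F (![0, 0, 1] : Fin 3 → Fin 2))) (rootDeltaChar (standardParabolicGL F (![0, 0, 1] : Fin 3 → Fin 2)))
            ⟨transvectionUnit 1 0 (by decide) y, transvectionUnit_one_zero_mem_standardParabolicGL y⟩ v - v} := by
  simp only [Representation.twist_apply, rootDeltaChar_transvectionUnit_one_zero, Units.val_one, one_smul, MonoidHom.coe_comp, Function.comp_apply]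
  exact mem_span_transvection_one_zero_sub F σ hσ hsc w

/-- **BLK HEAD (x₀₁, inducing-datum form) = JM-B's binder `hW₀₁`**: every `w ∈ W` lies in `⟨σ′ ⟨x₀₁ a, K0⟩ v − v⟩`.
[cite: HarishChandra1970, Part I §3 p. 9] [cite: BernsteinZelevinsky1977, §1.7] -/
theorem mem_span_twist_transvection_zero_one_sub {W : Type*} [AddCommGroup W] [Module ℂ W]
    (σ : Representation ℂ (Π a, GL {i // (![0, 0, 1] : Fin 3 → Fin 2) i = a} F) W) [σ.IsIrreducible] (hσ : σ.IsSmooth) (hsc : σ.IsSupercuspidal) (w : W) :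
    w ∈ Submodule.span ℂ {x : W | ∃ (a : F) (v : W),
      x = Representation.twist (σ.comp (leviProjection F (![0, 0, 1] : Fin 3 → Fin 2))) (rootDeltaChar (standardParabolicGL F (![0, 0, 1] : Fin 3 → Fin 2)))
            ⟨transvectionUnit 0 1 (by decide) a, transvectionUnit_zero_one_mem_standardParabolicGL a⟩ v - v} := by
  simp only [Representation.twist_apply, rootDeltaChar_transvectionUnit_zero_one, Units.val_one, one_smul, MonoidHom.coe_comp, Function.comp_apply]
  exact mem_span_transvection_zero_one_sub F σ hσ hsc w

/-! ## §4  `U` acts trivially and the Levi acts irreducibly through `σ′` (JM-A's `htriv` ∕ `hirr`, JM-B's `hirr`) -/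

/-- **JM-A's letter `htriv`: `σ′ u = 1` on `W` for `u ∈ U = unipotentRadicalP F c₀`** (`proj_{c₀} u = 1` as `U = ker proj`; `δ^{1∕2}(u) = 1`, ★
`rootDeltaChar_eq_one_of_mem_unipotentRadicalP`). [cite: BernsteinZelevinsky1977, §1.8] -/
theorem twist_leviProjection_apply_eq_self_of_mem_unipotentRadicalP {W : Type*} [AddCommGroup W] [Module ℂ W]
    (σ : Representation ℂ (Π a, GL {i // (![0, 0, 1] : Fin 3 → Fin 2) i = a} F) W) (u : ↥(standardParabolicGL F (![0, 0, 1] : Fin 3 → Fin 2)))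
    (hu : u ∈ unipotentRadicalP F (![0, 0, 1] : Fin 3 → Fin 2)) (w : W) :
    Representation.twist (σ.comp (leviProjection F (![0, 0, 1] : Fin 3 → Fin 2))) (rootDeltaChar (standardParabolicGL F (![0, 0, 1] : Fin 3 → Fin 2))) u w = w := by
  rw [Representation.twist_apply, rootDeltaChar_eq_one_of_mem_unipotentRadicalP F _ hu, Units.val_one, one_smul, MonoidHom.comp_apply,
    (MonoidHom.mem_ker).1 hu, map_one, Module.End.one_apply]

/-- **JM-A's letter `hirr`: a submodule `Y ≤ W` stable under `σ′ (leviEmbeddingP F c₀ m)` for all `m : Π_a GL {i ∕∕ c₀ i = a} F` is `⊥` or `⊤`** (`σ` irreducible;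
`proj_{c₀} ∘ leviEmbeddingP = id`, ★ `leviProjection_leviEmbeddingP`, and `δ^{1∕2} ≠ 0`). [cite: BernsteinZelevinsky1976, §2.10] [cite: BernsteinZelevinsky1977, §2.1] -/
theorem forall_submodule_eq_bot_or_top_of_leviStable {W : Type*} [AddCommGroup W] [Module ℂ W]
    (σ : Representation ℂ (Π a, GL {i // (![0, 0, 1] : Fin 3 → Fin 2) i = a} F) W) [σ.IsIrreducible] (Y : Submodule ℂ W)
    (hY : ∀ (m : Π a, GL {i // (![0, 0, 1] : Fin 3 → Fin 2) i = a} F) (y : W), y ∈ Y →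
      Representation.twist (σ.comp (leviProjection F (![0, 0, 1] : Fin 3 → Fin 2))) (rootDeltaChar (standardParabolicGL F (![0, 0, 1] : Fin 3 → Fin 2)))
        (leviEmbeddingP F (![0, 0, 1] : Fin 3 → Fin 2) m) y ∈ Y) :
    Y = ⊥ ∨ Y = ⊤ := by
  have hstab : ∀ (m : Π a, GL {i // (![0, 0, 1] : Fin 3 → Fin 2) i = a} F) (y : W), y ∈ Y → σ m y ∈ Y := by
    intro m y hy
    have h := hY m y hy
    rw [Representation.twist_apply, MonoidHom.comp_apply, show leviProjection F (![0, 0, 1] : Fin 3 → Fin 2) (leviEmbeddingP F _ m) = m from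
      DFunLike.congr_fun (leviProjection_leviEmbeddingP F (![0, 0, 1] : Fin 3 → Fin 2)) m] at h
    exact (Submodule.smul_mem_iff Y (Units.ne_zero _)).1 h
  rcases IsSimpleOrder.eq_bot_or_eq_top (⟨Y, fun l _ hx => hstab l _ hx⟩ : Subrepresentation σ) with h | h
  · exact Or.inl (congrArg Subrepresentation.toSubmodule h)
  · exact Or.inr (congrArg Subrepresentation.toSubmodule h)

omit [ValuativeRel F] [TopologicalSpace F] [IsNonarchimedeanLocalField F] in
/-- **`w₀ M′ w₀⁻¹ ⊆ M`**: `m ∈ M′ = standardLeviGL F ![0,1,1]` ⇒ `w₀ m w₀⁻¹ ∈ M = standardLeviGL F ![0,0,1]`, `w₀ = permGL Fin.revPerm` (★ `coe_permGL_mul_mul_inv`). [cite: BernsteinZelevinsky1977, §2.1] -/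
theorem permGL_rev_conj_mem_standardLeviGL_twoOne {m : GL (Fin 3) F} (hm : m ∈ standardLeviGL F (![0, 1, 1] : Fin 3 → Fin 2)) :
    (permGL Fin.revPerm : GL (Fin 3) F) * m * (permGL Fin.revPerm)⁻¹ ∈ standardLeviGL F (![0, 0, 1] : Fin 3 → Fin 2) := by
  rw [mem_standardLeviGL_iff] at hm ⊢
  intro a b hab
  rw [coe_permGL_mul_mul_inv, Matrix.submatrix_apply]
  refine hm _ _ ?_
  fin_cases a <;> fin_cases b <;> simp [Fin.revPerm_apply] at hab ⊢

omit [ValuativeRel F] [TopologicalSpace F] [IsNonarchimedeanLocalField F] in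
/-- **`w₀ M w₀⁻¹ ⊆ M′`**: for `m ∈ M = standardLeviGL F ![0,0,1]`, `w₀ m w₀⁻¹ ∈ M′ = standardLeviGL F ![0,1,1]`. [cite: BernsteinZelevinsky1977, §2.1] -/
theorem permGL_rev_conj_mem_standardLeviGL_oneTwo {m : GL (Fin 3) F} (hm : m ∈ standardLeviGL F (![0, 0, 1] : Fin 3 → Fin 2)) :
    (permGL Fin.revPerm : GL (Fin 3) F) * m * (permGL Fin.revPerm)⁻¹ ∈ standardLeviGL F (![0, 1, 1] : Fin 3 → Fin 2) := by
  rw [mem_standardLeviGL_iff] at hm ⊢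
  intro a b hab
  rw [coe_permGL_mul_mul_inv, Matrix.submatrix_apply]
  refine hm _ _ ?_
  fin_cases a <;> fin_cases b <;> simp [Fin.revPerm_apply] at hab ⊢

omit [ValuativeRel F] [TopologicalSpace F] [IsNonarchimedeanLocalField F] in
/-- `w₀ (w₀ g w₀⁻¹) w₀⁻¹ = g` (`w₀ = permGL Fin.revPerm` is an involution). [cite: BernsteinZelevinsky1977, §2.1] -/
theorem permGL_rev_conj_conj (g : GL (Fin 3) F) :
    (permGL Fin.revPerm : GL (Fin 3) F) * ((permGL Fin.revPerm : GL (Fin 3) F) * g * (permGL Fin.revPerm)⁻¹) * (permGL Fin.revPerm)⁻¹ = g := by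
  have hw : ((permGL Fin.revPerm : GL (Fin 3) F))⁻¹ = permGL Fin.revPerm := by
    rw [permGL_inv, Equiv.Perm.inv_def, Fin.revPerm_symm]
  have h2 : (permGL Fin.revPerm : GL (Fin 3) F) * permGL Fin.revPerm = 1 :=
    calc (permGL Fin.revPerm : GL (Fin 3) F) * permGL Fin.revPerm = (permGL Fin.revPerm)⁻¹ * permGL Fin.revPerm := by rw [hw]
      _ = 1 := inv_mul_cancel _
  rw [hw]
  calc (permGL Fin.revPerm : GL (Fin 3) F) * ((permGL Fin.revPerm : GL (Fin 3) F) * g * permGL Fin.revPerm) * permGL Fin.revPerm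
      = ((permGL Fin.revPerm : GL (Fin 3) F) * permGL Fin.revPerm) * g * ((permGL Fin.revPerm : GL (Fin 3) F) * permGL Fin.revPerm) := by group
    _ = g := by rw [h2, one_mul, mul_one]

omit [ValuativeRel F] [TopologicalSpace F] [IsNonarchimedeanLocalField F] in
/-- `w₀ · blockDiagonalGL F ![0,1,1] m · w₀⁻¹ ∈ P = P_{c₀}` (it lies in `M`). [cite: BernsteinZelevinsky1977, §2.1] -/
theorem permGL_rev_conj_blockDiagonalGL_mem (m : Π a, GL {i // (![0, 1, 1] : Fin 3 → Fin 2) i = a} F) :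
    (permGL Fin.revPerm : GL (Fin 3) F) * blockDiagonalGL F (![0, 1, 1] : Fin 3 → Fin 2) m * (permGL Fin.revPerm)⁻¹ ∈
      standardParabolicGL F (![0, 0, 1] : Fin 3 → Fin 2) :=
  standardLeviGL_le _ _ (permGL_rev_conj_mem_standardLeviGL_twoOne F ⟨m, rfl⟩)

/-- **JM-B's letter `hirr`: a submodule `Y ≤ W` stable under `σ′ ⟨w₀ · blockDiagonalGL F ![0,1,1] m · w₀⁻¹, _⟩` for all `m : Π_a GL {i ∕∕ ![0,1,1] i = a} F` is `⊥` or `⊤`**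
(`w₀ M w₀⁻¹ = M′`, `w₀² = 1`, then `forall_submodule_eq_bot_or_top_of_leviStable`). [cite: BernsteinZelevinsky1976, §2.10] [cite: BernsteinZelevinsky1977, §2.1] -/
theorem forall_submodule_eq_bot_or_top_of_leviStable_rev {W : Type*} [AddCommGroup W] [Module ℂ W]
    (σ : Representation ℂ (Π a, GL {i // (![0, 0, 1] : Fin 3 → Fin 2) i = a} F) W) [σ.IsIrreducible] (Y : Submodule ℂ W)
    (hY : ∀ (m : Π a, GL {i // (![0, 1, 1] : Fin 3 → Fin 2) i = a} F) (y : W), y ∈ Y →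
      Representation.twist (σ.comp (leviProjection F (![0, 0, 1] : Fin 3 → Fin 2))) (rootDeltaChar (standardParabolicGL F (![0, 0, 1] : Fin 3 → Fin 2)))
        ⟨(permGL Fin.revPerm : GL (Fin 3) F) * blockDiagonalGL F (![0, 1, 1] : Fin 3 → Fin 2) m * (permGL Fin.revPerm)⁻¹,
          permGL_rev_conj_blockDiagonalGL_mem F m⟩ y ∈ Y) :
    Y = ⊥ ∨ Y = ⊤ := by
  refine forall_submodule_eq_bot_or_top_of_leviStable F σ Y fun m₀ y hy => ?_
  -- `w₀ (diag m₀) w₀⁻¹ ∈ M′` is `blockDiagonalGL F c₁ m` for some `m`, and `w₀ (w₀ (diag m₀) w₀⁻¹) w₀⁻¹ = diag m₀`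
  obtain ⟨m, hm⟩ := permGL_rev_conj_mem_standardLeviGL_oneTwo F
    (show blockDiagonalGL F (![0, 0, 1] : Fin 3 → Fin 2) m₀ ∈ standardLeviGL F (![0, 0, 1] : Fin 3 → Fin 2) from ⟨m₀, rfl⟩)
  rw [leviEmbedding_apply] at hm
  have heq : (⟨(permGL Fin.revPerm : GL (Fin 3) F) * blockDiagonalGL F (![0, 1, 1] : Fin 3 → Fin 2) m * (permGL Fin.revPerm)⁻¹,
      permGL_rev_conj_blockDiagonalGL_mem F m⟩ : ↥(standardParabolicGL F (![0, 0, 1] : Fin 3 → Fin 2))) = leviEmbeddingP F (![0, 0, 1] : Fin 3 → Fin 2) m₀ :=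
    Subtype.ext (by
      change (permGL Fin.revPerm : GL (Fin 3) F) * blockDiagonalGL F (![0, 1, 1] : Fin 3 → Fin 2) m * (permGL Fin.revPerm)⁻¹ = (leviEmbeddingP F _ m₀ : GL (Fin 3) F)
      rw [coe_leviEmbeddingP, hm, permGL_rev_conj_conj])
  have h := hY m y hy
  rwa [heq] at h

end Summit.HodgeConjecture.HodgeConjecture.Cruxes.H413.K2E3GL3CuspidalBlockRestriction

end
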